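import Mathlib.FieldTheory.PurelyInseparable.Basic
import Mathlib.RingTheory.Localization.BaseChange
import Mathlib.RingTheory.Localization.Away.Basic
import Mathlib.RingTheory.TensorProduct.MvPolynomial
import Mathlib.RingTheory.MvPolynomial.Basic
import Mathlib.RingTheory.Spectrum.Prime.Topology
import Mathlib.RingTheory.FiniteType
import Mathlib.RingTheory.Flat.Basic
import Mathlib.Algebra.MvPolynomial.Funext
import Mathlib.Algebra.CharP.Frobenius
import Mathlib.FieldTheory.Perfect
import HarnessLib

/-!
# [OURS · L1 W8.2] Algebra for the inverse perfection step IN MANY VARIABLES: `E ⊗_M M(x_σ)` is a domain, and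
# `M`-rational closed points are dense in finitely generated subalgebras of `M(x_σ)^{perf}` (`σ` arbitrary)

Cell `res-hironaka` (run/shared/lean/pub/res-hironaka/), LADDER-RESOLUTION rung L (RESCUE), slot W8.2; host route
`UniversalCells`, host item `PrimeFieldToPerfect` (stmt-ResolutionOfSingularities-15233), door 1. Proofs file
(Mathlib-only imports + `HarnessLib`), written by res-L1-s82-pv-1 (gen 4): the many-variables form of
`…PerfectionDescentAlgebra.lean` (there `σ = 1`, `M(t)`), needed for descent from the ONE field
`Ω = (𝔽_p(x₀, x₁, …))^{perf}` to the finite levels of the rational tower (infinitely many variables at once).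

* §1 `isDomain_fractionRingMvPolynomial_tensor` / `isDomain_tensor_fractionRingMvPolynomial` — for fields
  `M ⊆ E` and any index type `σ`, `Frac(M[x_σ]) ⊗_M E` is a domain (a localisation of `M[x_σ] ⊗_M E ≅ E[x_σ]`,
  Mathlib `MvPolynomial.scalarRTensorAlgEquiv`, `IsLocalization.tensorProduct_tensorProduct`);
* §2 `exists_rationalPoint_of_ringHom_fractionRingMvPolynomial` — for `M` INFINITE, `R` finitely generated over
  `M` with an injective ring map `φ : R → Frac(M[x_σ])` semilinear along an automorphism `τ` of `M`, every
  non-empty open `O ⊆ Spec R` contains a maximal ideal `𝔪` with `M → R/𝔪` bijective: clear denominators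
  (`φ(R) ⊆ B := M[x_σ][1/Q]`), shrink `O` to a basic open `D(g)`, `g = P/Q^k`, and evaluate at a point `a ∈ M^σ`
  with `P(a)Q(a) ≠ 0` (Mathlib `MvPolynomial.funext`: a non-zero polynomial over an infinite domain is a
  non-zero function);
* §3 `exists_rationalPoint_of_algHom_of_isPurelyInseparable_mv` — the same for an injective `M`-ALGEBRA map
  into a field `L` purely inseparable over `Frac(M[x_σ])`, `M` perfect infinite of characteristic `p` (some
  `Frob^e ∘ ψ` lands in `Frac(M[x_σ])` and is semilinear along the automorphism `Frob^e` of `M`).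

HONEST FRAMING. OURS lemmas (commutative algebra, folklore); NOT statements of H. Hironaka's manuscript; nothing
attributed to its author. AI work, weaker than expert review.
-/

noncomputable section

set_option linter.dupNamespace false -- mandated namespace of this single-conjunct summit

open MvPolynomial TensorProduct

namespace Summit.ResolutionOfSingularities.ResolutionOfSingularities.Theorems.CampaignW82

/-! ## §1 `Frac(M[x_σ]) ⊗_M E` is a domain -/

/-- **`Frac(M[x_σ]) ⊗_M E` is a domain** for fields `M ⊆ E` and any `σ`: it is the localisation of
`M[x_σ] ⊗_M E ≅ E[x_σ]` (a domain) at the image of `M[x_σ] ∖ 0`, which consists of non-zero-divisors. [folklore] -/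
theorem isDomain_fractionRingMvPolynomial_tensor (M E : Type) [Field M] [Field E] [Algebra M E] (σ : Type) :
    IsDomain (FractionRing (MvPolynomial σ M) ⊗[M] E) := by
  let Rp := MvPolynomial σ M
  let K := FractionRing Rp
  let e₀ : Rp ⊗[M] E ≃ₐ[M] MvPolynomial σ E :=
    (Algebra.TensorProduct.comm M Rp E).trans ((MvPolynomial.scalarRTensorAlgEquiv).restrictScalars M)
  haveI : IsDomain (Rp ⊗[M] E) := MulEquiv.isDomain (MvPolynomial σ E) e₀.toMulEquiv
  letI : Algebra (Rp ⊗[M] E) (K ⊗[M] E) :=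
    (Algebra.TensorProduct.map (IsScalarTower.toAlgHom M Rp K) (AlgHom.id M E)).toRingHom.toAlgebra
  haveI : IsScalarTower Rp (Rp ⊗[M] E) (K ⊗[M] E) :=
    IsScalarTower.of_algebraMap_eq (R := Rp) (S := Rp ⊗[M] E) (A := K ⊗[M] E) fun P => by
    rw [RingHom.algebraMap_toAlgebra, Algebra.TensorProduct.algebraMap_apply, AlgHom.toRingHom_eq_coe,
      AlgHom.coe_toRingHom, Algebra.TensorProduct.algebraMap_apply, Algebra.algebraMap_self, RingHom.id_apply,
      Algebra.TensorProduct.map_tmul, map_one, IsScalarTower.coe_toAlgHom']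
  have H : (algebraMap (Rp ⊗[M] E) (K ⊗[M] E)).comp
      Algebra.TensorProduct.includeRight.toRingHom = Algebra.TensorProduct.includeRight.toRingHom := by
    ext x
    simp [RingHom.algebraMap_toAlgebra]
  haveI hloc := IsLocalization.tensorProduct_tensorProduct M E (nonZeroDivisors Rp) K H
  refine IsLocalization.isDomain_of_le_nonZeroDivisors (R := Rp ⊗[M] E) (K ⊗[M] E)
    (M := Algebra.algebraMapSubmonoid (Rp ⊗[M] E) (nonZeroDivisors Rp)) ?_
  rintro _ ⟨P, hP, rfl⟩
  refine mem_nonZeroDivisors_of_ne_zero ?_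
  rw [Algebra.TensorProduct.algebraMap_apply, Algebra.algebraMap_self, RingHom.id_apply]
  intro h0
  have hinj := Algebra.TensorProduct.includeLeft_injective (R := M) (A := Rp) (S := M) (B := E)
    (algebraMap M E).injective
  exact nonZeroDivisors.ne_zero hP (hinj (by simpa using h0))

/-- The same with the factors swapped: **`E ⊗_M Frac(M[x_σ])` is a domain.** [folklore] -/
theorem isDomain_tensor_fractionRingMvPolynomial (M E : Type) [Field M] [Field E] [Algebra M E] (σ : Type) :
    IsDomain (E ⊗[M] FractionRing (MvPolynomial σ M)) :=
  haveI := isDomain_fractionRingMvPolynomial_tensor M E σ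
  MulEquiv.isDomain (FractionRing (MvPolynomial σ M) ⊗[M] E)
    (Algebra.TensorProduct.comm M E (FractionRing (MvPolynomial σ M))).toMulEquiv


/-! ## §2 Rational points of finitely generated subalgebras of `Frac(M[x_σ])` -/

/-- **`M`-RATIONAL CLOSED POINTS ARE DENSE in `Spec R` for `R` finitely generated over an infinite field `M`
with an injective ring map `φ : R → Frac(M[x_σ])`, semilinear along an automorphism `τ` of `M`.** Proof: choose
`(a_r, b_r)` with `φ(r) = a_r / b_r` for the generators `r`, `Q := ∏ b_r`, `B := M[x_σ][1/Q] ↪ Frac(M[x_σ])`; then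
`φ` factors through an injective `j : R → B`, `Spec B ⟶ Spec R` is dominant, and the preimage of `O` contains a
basic open `D(g)`, `g · Q^k = P ≠ 0`; at a point `a ∈ M^σ` with `P(a) Q(a) ≠ 0` (a non-zero polynomial over an
infinite domain does not vanish identically, Mathlib `MvPolynomial.funext`) evaluation `B → M` has kernel a
maximal ideal in `D(g)`, whose image in `Spec R` is the required point. [folklore] -/
theorem exists_rationalPoint_of_ringHom_fractionRingMvPolynomial {M : Type} [Field M] [Infinite M] {σ : Type}
    {R : Type} [CommRing R] [Algebra M R] [hft : Algebra.FiniteType M R]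
    (φ : R →+* FractionRing (MvPolynomial σ M)) (hφ : Function.Injective φ)
    (τ : M ≃+* M) (hτ : ∀ c : M, φ (algebraMap M R c) = algebraMap M (FractionRing (MvPolynomial σ M)) (τ c))
    {O : Set (PrimeSpectrum R)} (hO : IsOpen O) (hne : O.Nonempty) :
    ∃ x ∈ O, x.asIdeal.IsMaximal ∧ Function.Bijective (algebraMap M (R ⧸ x.asIdeal)) := by
  classical
  obtain ⟨s, hs⟩ := hft.out
  let Rp := MvPolynomial σ M
  set K := FractionRing Rp with hK
  have halg_inj : Function.Injective (algebraMap Rp K) := IsFractionRing.injective Rp K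
  -- ### fractions for the generators, a common denominator `Q`, and `B = M[x_σ][1/Q]`
  have hfrac := fun r : R => IsLocalization.surj (nonZeroDivisors Rp) (φ r)
  choose ab hab using hfrac
  let Q : Rp := ∏ r ∈ s, ((ab r).2 : Rp)
  have hQ0 : Q ≠ 0 := Finset.prod_ne_zero_iff.mpr fun r _ => nonZeroDivisors.ne_zero (ab r).2.2
  let B : Type := Localization.Away Q
  have hQle : Submonoid.powers Q ≤ nonZeroDivisors Rp := powers_le_nonZeroDivisors_of_noZeroDivisors hQ0
  haveI : IsDomain B := IsLocalization.isDomain_localization hQle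
  -- ### `jB : B → Frac(M[x_σ])`, injective
  have hQK : IsUnit (algebraMap Rp K Q) := isUnit_iff_ne_zero.mpr ((map_ne_zero_iff _ halg_inj).mpr hQ0)
  let jB : B →+* K := IsLocalization.Away.lift Q hQK
  have hjB_alg : ∀ P : Rp, jB (algebraMap Rp B P) = algebraMap Rp K P :=
    fun P => IsLocalization.Away.lift_eq Q hQK P
  have hjB_M : ∀ c : M, jB (algebraMap M B c) = algebraMap M K c := fun c => by
    rw [IsScalarTower.algebraMap_apply M Rp B, hjB_alg, ← IsScalarTower.algebraMap_apply M Rp K]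
  have hjB_inj : Function.Injective jB := by
    rw [RingHom.injective_iff_ker_eq_bot]
    have hcomap : (RingHom.ker jB).under Rp = ⊥ := by
      change (RingHom.ker jB).comap (algebraMap Rp B) = ⊥
      rw [RingHom.comap_ker, IsLocalization.Away.lift_comp, ← RingHom.injective_iff_ker_eq_bot]
      exact halg_inj
    rw [← IsLocalization.map_under (Submonoid.powers Q) B (RingHom.ker jB), hcomap, Ideal.map_bot]
  -- ### `φ(R) ⊆ jB(B)`
  have hmem : ∀ r : R, φ r ∈ jB.range := by
    let T : Subalgebra M R :=
      { (jB.range.comap φ : Subring R) with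
        algebraMap_mem' := fun c => ⟨algebraMap M B (τ c), by rw [hjB_M, ← hτ]⟩ }
    have hsT : (↑s : Set R) ⊆ T := by
      intro r hr
      change φ r ∈ jB.range
      have hdvd : ((ab r).2 : Rp) ∣ Q := Finset.dvd_prod_of_mem (fun r => ((ab r).2 : Rp)) hr
      obtain ⟨u, hu⟩ := IsLocalization.Away.isUnit_of_dvd (S := B) (x := Q) hdvd
      refine ⟨algebraMap Rp B (ab r).1 * ↑u⁻¹, ?_⟩
      have hb : algebraMap Rp K (ab r).2 ≠ 0 :=
        (map_ne_zero_iff _ halg_inj).mpr (nonZeroDivisors.ne_zero (ab r).2.2)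
      rw [map_mul, map_units_inv, hu, hjB_alg, hjB_alg, ← div_eq_mul_inv, div_eq_iff hb]
      exact (hab r).symm
    have hT : T = ⊤ := top_le_iff.mp (hs ▸ Algebra.adjoin_le hsT)
    intro r
    have : r ∈ T := hT ▸ Algebra.mem_top
    exact this
  -- ### the factorisation `j : R → B`
  have hrr_inj : Function.Injective jB.rangeRestrict := fun b₁ b₂ h => hjB_inj (congrArg Subtype.val h)
  let eB : B ≃+* jB.range := RingEquiv.ofBijective jB.rangeRestrict ⟨hrr_inj, jB.rangeRestrict_surjective⟩
  let j : R →+* B := eB.symm.toRingHom.comp (φ.codRestrict jB.range hmem)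
  have hj : ∀ r, jB (j r) = φ r := fun r => by
    have h1 : (eB (eB.symm (φ.codRestrict jB.range hmem r)) : K) = φ r := by
      rw [eB.apply_symm_apply]; rfl
    exact h1
  have hj_inj : Function.Injective j := fun r₁ r₂ h => hφ (by rw [← hj, ← hj, h])
  have hj_M : ∀ c : M, j (algebraMap M R c) = algebraMap M B (τ c) := fun c =>
    hjB_inj (by rw [hj, hτ, hjB_M])
  -- ### `Spec B ⟶ Spec R` is dominant; a basic open `D(g)` inside the preimage of `O`
  let cj : PrimeSpectrum B → PrimeSpectrum R := PrimeSpectrum.comap j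
  have hcj : Continuous cj := PrimeSpectrum.continuous_comap j
  have hdense : DenseRange cj := by
    rw [PrimeSpectrum.denseRange_comap_iff_ker_le_nilRadical, (RingHom.injective_iff_ker_eq_bot j).mp hj_inj]
    exact bot_le
  have hO'ne : (cj ⁻¹' O).Nonempty := hdense.exists_mem_open hO hne
  obtain ⟨_, ⟨g, rfl⟩, hgne, hgO⟩ := PrimeSpectrum.isTopologicalBasis_basic_opens.exists_subset_of_mem_open
    hO'ne.some_mem (hO.preimage hcj)
  -- `g ≠ 0` (the basic open is non-empty), `g · Q^k = P`
  have hg0 : g ≠ 0 := by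
    rintro rfl
    have h1 : hO'ne.some ∈ (PrimeSpectrum.basicOpen (0 : B) : Set (PrimeSpectrum B)) := hgne
    simp [PrimeSpectrum.basicOpen_zero] at h1
  obtain ⟨⟨P, ⟨_, ⟨k, rfl⟩⟩⟩, hgP⟩ := IsLocalization.surj (Submonoid.powers Q) g
  have hP0 : P ≠ 0 := by
    intro hP
    apply hg0
    have h1 : g * algebraMap Rp B (Q ^ k) = 0 := by rw [hgP]; simp [hP]
    rcases mul_eq_zero.mp h1 with h | h
    · exact h
    · refine absurd h ?_
      rw [map_pow]
      exact (IsLocalization.Away.algebraMap_pow_isUnit (S := B) (x := Q) k).ne_zero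
  -- ### a point `a ∈ M^σ` with `P(a) Q(a) ≠ 0`
  obtain ⟨a, ha⟩ : ∃ a : σ → M, MvPolynomial.eval a (P * Q) ≠ 0 := by
    by_contra hcon
    simp only [not_exists, not_not] at hcon
    exact (mul_ne_zero hP0 hQ0) (MvPolynomial.funext fun a => by rw [hcon a, map_zero])
  rw [map_mul] at ha
  have hPa : MvPolynomial.eval a P ≠ 0 := left_ne_zero_of_mul ha
  have hQa : MvPolynomial.eval a Q ≠ 0 := right_ne_zero_of_mul ha
  -- evaluation at `a` extends to `B`
  have hu : IsUnit (MvPolynomial.eval a Q) := isUnit_iff_ne_zero.mpr hQa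
  let ev : B →+* M := IsLocalization.Away.lift Q (g := (MvPolynomial.eval a : Rp →+* M)) hu
  have hevP : ∀ P' : Rp, ev (algebraMap Rp B P') = MvPolynomial.eval a P' :=
    fun P' => IsLocalization.Away.lift_eq Q hu P'
  have hevM : ∀ c : M, ev (algebraMap M B c) = c := fun c => by
    rw [IsScalarTower.algebraMap_apply M Rp B, hevP]
    exact MvPolynomial.eval_C c
  let m : PrimeSpectrum B := ⟨RingHom.ker ev, RingHom.ker_isPrime _⟩
  have hm : m ∈ cj ⁻¹' O := by
    apply hgO
    change g ∉ RingHom.ker ev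
    rw [RingHom.mem_ker]
    intro hg
    have h1 : ev (g * algebraMap Rp B (Q ^ k)) = MvPolynomial.eval a P := by rw [hgP, hevP]
    rw [map_mul, hg, zero_mul] at h1
    exact hPa h1.symm
  -- ### its image `x = ker (ev ∘ j)`
  let θ : R →+* M := ev.comp j
  have hθM : ∀ c : M, θ (algebraMap M R c) = τ c := fun c => by
    change ev (j (algebraMap M R c)) = τ c
    rw [hj_M, hevM]
  have hθsurj : Function.Surjective θ := fun c => ⟨algebraMap M R (τ.symm c), by rw [hθM, τ.apply_symm_apply]⟩
  have hxeq : (cj m).asIdeal = RingHom.ker θ := RingHom.comap_ker ev j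
  refine ⟨cj m, hm, ?_, ?_⟩
  · rw [hxeq]; exact RingHom.ker_isMaximal_of_surjective θ hθsurj
  · let e : R ⧸ (cj m).asIdeal ≃+* M :=
      (Ideal.quotEquivOfEq hxeq).trans (RingHom.quotientKerEquivOfSurjective hθsurj)
    have he : ∀ c : M, e (algebraMap M (R ⧸ (cj m).asIdeal) c) = τ c := fun c => by
      rw [← Ideal.Quotient.mk_algebraMap]
      change RingHom.quotientKerEquivOfSurjective hθsurj
        (Ideal.quotEquivOfEq hxeq (Ideal.Quotient.mk _ (algebraMap M R c))) = τ c
      rw [Ideal.quotEquivOfEq_mk, RingHom.quotientKerEquivOfSurjective_apply_mk, hθM]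
    have hcomp : (algebraMap M (R ⧸ (cj m).asIdeal) : M → _) = e.symm ∘ τ := by
      funext c
      exact e.injective (by rw [he]; simp)
    rw [hcomp]
    exact e.symm.bijective.comp τ.bijective

/-! ## §3 Rational points in a purely inseparable extension of `Frac(M[x_σ])` -/

/-- **`M`-RATIONAL CLOSED POINTS ARE DENSE in `Spec R` for `R` finitely generated over an INFINITE PERFECT field
`M` of characteristic `p` with an injective `M`-algebra map `ψ : R → L` into a field `L` purely inseparable over
`Frac(M[x_σ])`** (`σ` arbitrary): some `Frob^e ∘ ψ` lands in `Frac(M[x_σ])` and is semilinear along the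
automorphism `Frob^e` of `M`; apply `exists_rationalPoint_of_ringHom_fractionRingMvPolynomial`. [folklore] -/
theorem exists_rationalPoint_of_algHom_of_isPurelyInseparable_mv (p : ℕ) [hp : Fact p.Prime] {M : Type}
    [Field M] [CharP M p] [PerfectField M] [Infinite M] {σ : Type} {L : Type} [Field L]
    [Algebra (FractionRing (MvPolynomial σ M)) L] [IsPurelyInseparable (FractionRing (MvPolynomial σ M)) L]
    [Algebra M L] [IsScalarTower M (FractionRing (MvPolynomial σ M)) L]
    {R : Type} [CommRing R] [Algebra M R] [hft : Algebra.FiniteType M R] (ψ : R →ₐ[M] L)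
    (hψ : Function.Injective ψ) {O : Set (PrimeSpectrum R)} (hO : IsOpen O) (hne : O.Nonempty) :
    ∃ x ∈ O, x.asIdeal.IsMaximal ∧ Function.Bijective (algebraMap M (R ⧸ x.asIdeal)) := by
  classical
  set K := FractionRing (MvPolynomial σ M) with hK
  haveI : CharP K p := charP_of_injective_algebraMap (IsFractionRing.injective (MvPolynomial σ M) K) p
  haveI : CharP L p := charP_of_injective_algebraMap (algebraMap K L).injective p
  haveI : ExpChar K p := ExpChar.prime hp.out
  haveI : ExpChar L p := ExpChar.prime hp.out
  haveI : ExpChar M p := ExpChar.prime hp.out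
  obtain ⟨s, hs⟩ := hft.out
  have hpow := fun r : R => IsPurelyInseparable.pow_mem K p (ψ r)
  choose n hn using hpow
  let e : ℕ := s.sup n
  have hgen : ∀ r ∈ s, ψ r ^ p ^ e ∈ (algebraMap K L).range := by
    intro r hr
    have hle : n r ≤ e := Finset.le_sup hr
    rw [← Nat.add_sub_cancel' hle, pow_add, pow_mul]
    exact Subring.pow_mem _ (hn r) _
  let φ₀ : R →+* L := (iterateFrobenius L p e).comp ψ.toRingHom
  have hφ₀ : ∀ r, φ₀ r = ψ r ^ p ^ e := fun r => iterateFrobenius_def ..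
  have hφ₀M : ∀ c : M, φ₀ (algebraMap M R c) = algebraMap K L (algebraMap M K (c ^ p ^ e)) := fun c => by
    rw [hφ₀, AlgHom.commutes, ← map_pow, IsScalarTower.algebraMap_apply M K L]
  have hmemL : ∀ r : R, φ₀ r ∈ (algebraMap K L).range := by
    let T : Subalgebra M R :=
      { ((algebraMap K L).range.comap φ₀ : Subring R) with
        algebraMap_mem' := fun c => ⟨algebraMap M K (c ^ p ^ e), (hφ₀M c).symm⟩ }
    have hsT : (↑s : Set R) ⊆ T := fun r hr => by
      change φ₀ r ∈ (algebraMap K L).range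
      rw [hφ₀]; exact hgen r hr
    have hT : T = ⊤ := top_le_iff.mp (hs ▸ Algebra.adjoin_le hsT)
    intro r
    have : r ∈ T := hT ▸ Algebra.mem_top
    exact this
  have hrr_inj : Function.Injective (algebraMap K L).rangeRestrict :=
    fun b₁ b₂ h => (algebraMap K L).injective (congrArg Subtype.val h)
  let eKL : K ≃+* (algebraMap K L).range :=
    RingEquiv.ofBijective (algebraMap K L).rangeRestrict ⟨hrr_inj, (algebraMap K L).rangeRestrict_surjective⟩
  let φ : R →+* K := eKL.symm.toRingHom.comp (φ₀.codRestrict (algebraMap K L).range hmemL)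
  have hφ : ∀ r, algebraMap K L (φ r) = φ₀ r := fun r => by
    have h1 : (eKL (eKL.symm (φ₀.codRestrict (algebraMap K L).range hmemL r)) : L) = φ₀ r := by
      rw [eKL.apply_symm_apply]; rfl
    exact h1
  have hφ_inj : Function.Injective φ := by
    intro r₁ r₂ h
    have h' : φ₀ r₁ = φ₀ r₂ := by rw [← hφ, ← hφ, h]
    rw [hφ₀, hφ₀] at h'
    have h'' : iterateFrobenius L p e (ψ r₁) = iterateFrobenius L p e (ψ r₂) := by
      rwa [iterateFrobenius_def, iterateFrobenius_def]
    exact hψ (iterateFrobenius_inj L p e h'')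
  let τ : M ≃+* M := iterateFrobeniusEquiv M p e
  have hτ : ∀ c : M, φ (algebraMap M R c) = algebraMap M K (τ c) := fun c =>
    (algebraMap K L).injective (by rw [hφ, hφ₀M, iterateFrobeniusEquiv_def])
  exact exists_rationalPoint_of_ringHom_fractionRingMvPolynomial φ hφ_inj τ hτ hO hne

end Summit.ResolutionOfSingularities.ResolutionOfSingularities.Theorems.CampaignW82

end
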